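import Literature.NumberTheory.EllipticCurves.IntSeriesCurveSubstMul
import Literature.NumberTheory.EllipticCurves.IntSeriesOnePlusPowExponentLaws
import Literature.NumberTheory.EllipticCurves.IntSeriesNodeTransport
import Mathlib.RingTheory.PowerSeries.Binomial
import Mathlib.Tactic
import HarnessLib

set_option autoImplicit false

/-!
# The binomial series `(1+T)^y` with exponent `y ∈ ℂ_p` along a monomial curve: the formal composition law
# `((1+T)^c)^y = (1+T)^{y·c}` (`c ∈ ℤ_p`), i.e. the restriction of `(1+T₁)^x (1+T₂)^w` to the line
# `T_i = (1+T)^{c_i} − 1` is `(1+T)^{x c₁ + w c₂}` — for ALL `x, w ∈ ℂ_p` (proved as a polynomial identity in the exponent)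

Topic `NumberTheory/EllipticCurves` (receptacles `ℂ_p⟦T⟧`, `ℂ_p⟦T₁⟧⟦T₂⟧`; `IntSeries.curveSubst`, `IntSeries.binomPow`).
Gouvêa, *p-adic Numbers* §5.9 (p. 132): "it follows from an equality of formal power series that for
`α = a/b ∈ ℤ_{(p)}` … `(B(a/b, X))^b = (1+X)^a`" — the exponent calculus of the FORMAL binomial series
`B(y, X) = Σ C(y,n) Xⁿ` (Mathlib `PowerSeries.binomialSeries ℂ_p y`, `y` in the ℚ-algebra `ℂ_p`) is a family of
polynomial identities in `y`, true for `y ∈ ℕ` and hence for all `y`.  This file proves, in the tree's currency: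

* §1 `map_binomPow_eq_binomialSeries` — `(binomPow z).map (𝒪 ↪ ℂ_p) = binomialSeries ℂ_p z` (`z ∈ ℤ_p`);
  `binomialSeries_natCast_mul_padicInt` (`binomialSeries ℂ_p (m·c) = ((binomPow c).map)^m`);
  `ode_binomialSeries` — `(1+X)·B(y,X)′ = y·B(y,X)` (the tree's `ode_binomialSeries_mk` in `Ring.choose` currency).
* §2 `coeff_curveSubst_map_C`, `coeff_curveSubst_C` — restriction of an outer-only / inner-only two-variable series to a
  curve is the one-variable composition `Σ f_i a₁^i` / `Σ f_j a₂^j` (any commutative ring).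
* §3 **`curveSubst_map_C_binomialSeries`** / **`curveSubst_C_binomialSeries`** — for `c ∈ ℤ_p` and EVERY `y ∈ ℂ_p`:
  restricting `(1+T₁)^y` (resp. `(1+T₂)^y`) to a curve whose first (resp. second) component is `(1+T)^c − 1` gives
  `(1+T)^{y·c}` in `ℂ_p⟦T⟧`; **`curveSubst_binomialSeries₂`** — `(1+T₁)^x(1+T₂)^w ↦ (1+T)^{x c₁ + w c₂}`.

USE (cell `bsd-print-cf2`, route C, «(R) period rigidity» lane of item 23722): the two-variable rigidity identity is
assembled FORMALLY over `ℂ_p` with a-priori RATIONAL exponents `(x, w) ∈ ℚ_p²`; this composition law computes the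
restriction of the candidate unit `(1+T₁)^x(1+T₂)^w` to every supply line and to the generic lines on which the
exponents are then shown to be `p`-integral. THEOREMS ONLY (no definition, no named fact, no `sorry`).

## References

* F. Q. Gouvêa, *p-adic Numbers: An Introduction*, Universitext, Springer 1993, §5.9 (pp. 131–132).
  [Gouvea1993PadicNumbers]
* N. Koblitz, *p-adic Numbers, p-adic Analysis, and Zeta-Functions*, GTM 58, Ch. IV §1. [Koblitz1984]
-/

noncomputable section

open Finset PowerSeries
open Literature.NumberTheory.EllipticCurves.GreenbergVatsal2000
open Literature.NumberTheory.LocalFields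

namespace Literature.NumberTheory.EllipticCurves.IntSeries

variable {p : ℕ} [Fact p.Prime]

/-! ### §1. `binomPow` read in `ℂ_p⟦T⟧` is Mathlib's `binomialSeries ℂ_p` -/

/-- The coefficient embedding composed with `ℤ_p → 𝒪_{ℂ_p}` is `ℤ_p → ℚ_p → ℂ_p`. [cite: Koblitz1984, Ch. IV §1] -/
theorem subtype_padicIntToComplexInt (z : ℤ_[p]) :
    (PadicComplexInt p).toSubring.subtype (padicIntToComplexInt p z) = ((z : ℚ_[p]) : ℂ_[p]) := rfl

/-- **`(1+T)^z` (`z ∈ ℤ_p`) read in `ℂ_p⟦T⟧` is the binomial series of `z ∈ ℂ_p`.**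
[cite: Gouvea1993PadicNumbers, §5.9 (the binomial series `B(α, X)`, pp. 131–132)] -/
theorem map_binomPow_eq_binomialSeries (z : ℤ_[p]) :
    (binomPow z).map (PadicComplexInt p).toSubring.subtype = PowerSeries.binomialSeries ℂ_[p] (((z : ℚ_[p]) : ℂ_[p])) := by
  ext n
  rw [coeff_map, coeff_binomPow, PowerSeries.binomialSeries_coeff, smul_eq_mul, mul_one, subtype_padicIntToComplexInt]
  have h := Ring.map_choose ((PadicComplexInt p).toSubring.subtype.comp (padicIntToComplexInt p)) z n
  rw [RingHom.comp_apply, RingHom.comp_apply, subtype_padicIntToComplexInt, subtype_padicIntToComplexInt] at h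
  exact h

/-- `(1+T)^{m·c} = ((1+T)^c)^m` in `𝒪_{ℂ_p}⟦T⟧` for `m ∈ ℕ`. [cite: Gouvea1993PadicNumbers, §5.9 (`(B(a/b, X))^b = (1+X)^a`, p. 132)] -/
theorem binomPow_natCast_mul (m : ℕ) (c : ℤ_[p]) : binomPow ((m : ℤ_[p]) * c) = binomPow c ^ m := by
  induction m with
  | zero => rw [Nat.cast_zero, zero_mul, binomPow_zero, pow_zero]
  | succ m ih => rw [Nat.cast_succ, add_mul, one_mul, binomPow_add, ih, pow_succ]

/-- `binomialSeries ℂ_p (m·c) = ((binomPow c).map)^m` for `m ∈ ℕ`, `c ∈ ℤ_p`.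
[cite: Gouvea1993PadicNumbers, §5.9 (`(B(a/b, X))^b = (1+X)^a`, p. 132)] -/
theorem binomialSeries_natCast_mul_padicInt (m : ℕ) (c : ℤ_[p]) :
    PowerSeries.binomialSeries ℂ_[p] ((m : ℂ_[p]) * (((c : ℚ_[p]) : ℂ_[p]))) =
      ((binomPow c).map (PadicComplexInt p).toSubring.subtype) ^ m := by
  rw [← map_pow, ← binomPow_natCast_mul, map_binomPow_eq_binomialSeries]
  push_cast
  ring_nf

/-- `n!·C(y,n) = y(y−1)⋯(y−n+1)` in `ℂ_p`. [cite: Gouvea1993PadicNumbers, §5.9 Lemma 5.9.1] -/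
theorem factorial_mul_choose_eq_prod_padicComplex (y : ℂ_[p]) (n : ℕ) :
    (n.factorial : ℂ_[p]) * Ring.choose y n = ∏ j ∈ range n, (y - (j : ℂ_[p])) := by
  rw [← descPochhammer_eval_eq_prod_range, ← nsmul_eq_mul,
    ← Ring.descPochhammer_eq_factorial_smul_choose, ← Polynomial.eval₂_smulOneHom_eq_smeval,
    ← descPochhammer_map (Int.castRingHom ℂ_[p]), Polynomial.eval_map,
    Subsingleton.elim (Int.castRingHom ℂ_[p]) RingHom.smulOneHom]

/-- `C(y,n)` is the value at `y` of the polynomial `descPochhammer/n!`. [cite: Gouvea1993PadicNumbers, §5.9 Lemma 5.9.1] -/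
theorem choose_eq_eval_descPochhammer (y : ℂ_[p]) (n : ℕ) :
    Ring.choose y n = Polynomial.eval y (Polynomial.C ((n.factorial : ℂ_[p])⁻¹) * descPochhammer ℂ_[p] n) := by
  rw [Polynomial.eval_mul, Polynomial.eval_C, descPochhammer_eval_eq_prod_range,
    ← factorial_mul_choose_eq_prod_padicComplex, ← mul_assoc,
    inv_mul_cancel₀ (by exact_mod_cast Nat.factorial_ne_zero n), one_mul]

/-- **`(1+X)·B(y,X)′ = y·B(y,X)`** for the binomial series over `ℂ_p`.
[cite: Gouvea1993PadicNumbers, §5.9 (the binomial series `B(α, X)`, p. 131)] -/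
theorem ode_binomialSeries (y : ℂ_[p]) :
    (1 + X) * derivative ℂ_[p] (PowerSeries.binomialSeries ℂ_[p] y) = C y * PowerSeries.binomialSeries ℂ_[p] y := by
  have hB : PowerSeries.binomialSeries ℂ_[p] y =
      PowerSeries.mk fun n : ℕ ↦ (∏ j ∈ range n, (y - (j : ℂ_[p]))) / (n.factorial : ℂ_[p]) := by
    ext n
    rw [PowerSeries.binomialSeries_coeff, smul_eq_mul, mul_one, coeff_mk,
      eq_div_iff (by exact_mod_cast Nat.factorial_ne_zero n), mul_comm, factorial_mul_choose_eq_prod_padicComplex]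
  rw [hB]
  exact ode_binomialSeries_mk _

/-! ### §2. Restricting an outer-only / inner-only series to a curve -/

section Formal

variable {R : Type*} [CommRing R] (a₁ a₂ : PowerSeries R)

/-- **Outer-only series along a curve**: `[Tⁿ] (F(T₁))(a₁, a₂) = Σ_{i ≤ n} F_i·[Tⁿ]a₁^i`.
[cite: Koblitz1984, Ch. IV §1] -/
theorem coeff_curveSubst_map_C (F : PowerSeries R) (n : ℕ) :
    PowerSeries.coeff n (curveSubst a₁ a₂ (PowerSeries.map (PowerSeries.C (R := R)) F)) =
      ∑ i ∈ range (n + 1), PowerSeries.coeff i F * PowerSeries.coeff n (a₁ ^ i) := by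
  rw [coeff_curveSubst]
  refine sum_congr rfl fun i _ ↦ ?_
  rw [sum_eq_single 0]
  · rw [PowerSeries.coeff_map, PowerSeries.coeff_zero_C, pow_zero, mul_one]
  · intro j _ hj
    rw [PowerSeries.coeff_map, PowerSeries.coeff_C, if_neg hj, zero_mul]
  · simp

/-- **Inner-only series along a curve**: `[Tⁿ] (F(T₂))(a₁, a₂) = Σ_{j ≤ n} F_j·[Tⁿ]a₂^j`.
[cite: Koblitz1984, Ch. IV §1] -/
theorem coeff_curveSubst_C (F : PowerSeries R) (n : ℕ) :
    PowerSeries.coeff n (curveSubst a₁ a₂ (PowerSeries.C F)) =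
      ∑ j ∈ range (n + 1), PowerSeries.coeff j F * PowerSeries.coeff n (a₂ ^ j) := by
  rw [coeff_curveSubst, sum_eq_single 0]
  · refine sum_congr rfl fun j _ ↦ ?_
    rw [PowerSeries.coeff_zero_C, pow_zero, one_mul]
  · intro i _ hi
    exact sum_eq_zero fun j _ ↦ by rw [PowerSeries.coeff_C, if_neg hi, map_zero, zero_mul]
  · simp

/-- The inner-only series along `(a₁, a₂)` is the outer-only series along `(a₂, a₁)`.
[cite: Koblitz1984, Ch. IV §1] -/
theorem curveSubst_C_eq_curveSubst_map_C (F : PowerSeries R) :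
    curveSubst a₁ a₂ (PowerSeries.C F) = curveSubst a₂ a₁ (PowerSeries.map (PowerSeries.C (R := R)) F) := by
  ext n
  rw [coeff_curveSubst_C, coeff_curveSubst_map_C]

/-- `T₁` along a curve is `a₁`. [cite: Koblitz1984, Ch. IV §1] -/
theorem curveSubst_map_C_X (ha₁ : PowerSeries.constantCoeff a₁ = 0) :
    curveSubst a₁ a₂ (PowerSeries.map (PowerSeries.C (R := R)) PowerSeries.X) = a₁ := by
  ext n
  rw [coeff_curveSubst_map_C]
  rcases Nat.eq_zero_or_pos n with hn | hn
  · subst hn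
    rw [sum_range_one, PowerSeries.coeff_zero_X, zero_mul, PowerSeries.coeff_zero_eq_constantCoeff_apply, ha₁]
  · rw [sum_eq_single 1]
    · rw [PowerSeries.coeff_one_X, one_mul, pow_one]
    · intro i _ hi
      rw [PowerSeries.coeff_X, if_neg hi, zero_mul]
    · intro h
      exfalso
      exact h (mem_range.2 (by omega))

/-- `(1+T₁)^m` along a curve is `(1 + a₁)^m`. [cite: Koblitz1984, Ch. IV §1] -/
theorem curveSubst_map_C_one_add_X_pow (ha₁ : PowerSeries.constantCoeff a₁ = 0) (ha₂ : PowerSeries.constantCoeff a₂ = 0)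
    (m : ℕ) :
    curveSubst a₁ a₂ (PowerSeries.map (PowerSeries.C (R := R)) ((1 + PowerSeries.X) ^ m)) = (1 + a₁) ^ m := by
  rw [map_pow, curveSubst_pow ha₁ ha₂, map_add, map_one, curveSubst_add, curveSubst_one, curveSubst_map_C_X _ _ ha₁]

end Formal

/-! ### §3. The composition law `((1+T)^c)^y = (1+T)^{y·c}` for all `y ∈ ℂ_p` -/

/-- **The composition law, outer variable.** For `c ∈ ℤ_p`, any `y ∈ ℂ_p` and any second component `a₂` through the
origin: restricting `(1+T₁)^y` (the binomial series in the outer variable) along a curve with first component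
`(1+T)^c − 1` gives the binomial series `(1+T)^{y·c}` in `ℂ_p⟦T⟧`.  Both sides' coefficients are polynomials in `y` which
agree for `y ∈ ℕ` (`((1+T)^c)^m = (1+T)^{mc}`). [cite: Gouvea1993PadicNumbers, §5.9 (`(B(a/b, X))^b = (1+X)^a`, p. 132)] -/
theorem curveSubst_map_C_binomialSeries (c : ℤ_[p]) (y : ℂ_[p]) {a₂ : PowerSeries ℂ_[p]}
    (ha₂ : PowerSeries.constantCoeff a₂ = 0) :
    curveSubst ((binomPow c - 1).map (PadicComplexInt p).toSubring.subtype) a₂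
        (PowerSeries.map (PowerSeries.C (R := ℂ_[p])) (PowerSeries.binomialSeries ℂ_[p] y)) =
      PowerSeries.binomialSeries ℂ_[p] (y * (((c : ℚ_[p]) : ℂ_[p]))) := by
  set ι := (PadicComplexInt p).toSubring.subtype with hι
  set a₁ : PowerSeries ℂ_[p] := (binomPow c - 1).map ι with ha₁def
  have ha₁ : PowerSeries.constantCoeff a₁ = 0 := by
    rw [ha₁def, ← coeff_zero_eq_constantCoeff_apply, coeff_map, coeff_zero_eq_constantCoeff_apply,
      constantCoeff_binomPow_sub_one, map_zero]
  set c' : ℂ_[p] := ((c : ℚ_[p]) : ℂ_[p]) with hc'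
  ext n
  -- the two coefficient polynomials in `y`
  set chooseP : ℕ → Polynomial ℂ_[p] := fun i ↦ Polynomial.C ((i.factorial : ℂ_[p])⁻¹) * descPochhammer ℂ_[p] i
    with hchooseP
  have hchoose : ∀ (i : ℕ) (w : ℂ_[p]), Ring.choose w i = Polynomial.eval w (chooseP i) :=
    fun i w ↦ choose_eq_eval_descPochhammer w i
  set P : Polynomial ℂ_[p] := ∑ i ∈ range (n + 1), Polynomial.C (PowerSeries.coeff n (a₁ ^ i)) * chooseP i with hP
  set Q : Polynomial ℂ_[p] := (chooseP n).comp (Polynomial.C c' * Polynomial.X) with hQ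
  have hPeval : ∀ w : ℂ_[p], Polynomial.eval w P =
      PowerSeries.coeff n (curveSubst a₁ a₂ (PowerSeries.map (PowerSeries.C (R := ℂ_[p])) (PowerSeries.binomialSeries ℂ_[p] w))) := by
    intro w
    rw [coeff_curveSubst_map_C, hP, Polynomial.eval_finsetSum]
    refine sum_congr rfl fun i _ ↦ ?_
    rw [Polynomial.eval_mul, Polynomial.eval_C, ← hchoose, PowerSeries.binomialSeries_coeff, smul_eq_mul, mul_one, mul_comm]
  have hQeval : ∀ w : ℂ_[p], Polynomial.eval w Q = PowerSeries.coeff n (PowerSeries.binomialSeries ℂ_[p] (w * c')) := by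
    intro w
    rw [hQ, Polynomial.eval_comp, Polynomial.eval_mul_X, Polynomial.eval_C, ← hchoose,
      PowerSeries.binomialSeries_coeff, smul_eq_mul, mul_one, mul_comm w c']
  -- they agree on `ℕ`
  have hnat : ∀ m : ℕ, Polynomial.eval (m : ℂ_[p]) P = Polynomial.eval (m : ℂ_[p]) Q := by
    intro m
    rw [hPeval, hQeval, PowerSeries.binomialSeries_nat, curveSubst_map_C_one_add_X_pow _ _ ha₁ ha₂,
      binomialSeries_natCast_mul_padicInt, ha₁def, ← hι]
    congr 2
    rw [map_sub, map_one, add_sub_cancel]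
  have hPQ : P = Q := by
    refine Polynomial.eq_of_infinite_eval_eq P Q ?_
    have hsub : Set.range (fun m : ℕ ↦ (m : ℂ_[p])) ⊆ {w | Polynomial.eval w P = Polynomial.eval w Q} := by
      rintro _ ⟨m, rfl⟩; exact hnat m
    exact (Set.infinite_range_of_injective Nat.cast_injective).mono hsub
  have h := congrArg (Polynomial.eval y) hPQ
  rwa [hPeval, hQeval] at h

/-- **The composition law, inner variable**: restricting `(1+T₂)^y` along a curve with second component `(1+T)^c − 1`
gives `(1+T)^{y·c}`. [cite: Gouvea1993PadicNumbers, §5.9 (`(B(a/b, X))^b = (1+X)^a`, p. 132)] -/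
theorem curveSubst_C_binomialSeries (c : ℤ_[p]) (y : ℂ_[p]) {a₁ : PowerSeries ℂ_[p]}
    (ha₁ : PowerSeries.constantCoeff a₁ = 0) :
    curveSubst a₁ ((binomPow c - 1).map (PadicComplexInt p).toSubring.subtype)
        (PowerSeries.C (PowerSeries.binomialSeries ℂ_[p] y)) =
      PowerSeries.binomialSeries ℂ_[p] (y * (((c : ℚ_[p]) : ℂ_[p]))) := by
  rw [curveSubst_C_eq_curveSubst_map_C, curveSubst_map_C_binomialSeries c y ha₁]

/-- **`(1+T₁)^x (1+T₂)^w` along the line `T_i = (1+T)^{c_i} − 1` is `(1+T)^{x c₁ + w c₂}`** in `ℂ_p⟦T⟧`, for ALL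
`x, w ∈ ℂ_p`. [cite: Gouvea1993PadicNumbers, §5.9 (`(B(a/b, X))^b = (1+X)^a`, p. 132)] -/
theorem curveSubst_binomialSeries₂ (c₁ c₂ : ℤ_[p]) (x w : ℂ_[p]) :
    curveSubst ((binomPow c₁ - 1).map (PadicComplexInt p).toSubring.subtype)
        ((binomPow c₂ - 1).map (PadicComplexInt p).toSubring.subtype)
        (PowerSeries.map (PowerSeries.C (R := ℂ_[p])) (PowerSeries.binomialSeries ℂ_[p] x) *
          PowerSeries.C (PowerSeries.binomialSeries ℂ_[p] w)) =
      PowerSeries.binomialSeries ℂ_[p] (x * (((c₁ : ℚ_[p]) : ℂ_[p])) + w * (((c₂ : ℚ_[p]) : ℂ_[p]))) := by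
  have h0 : ∀ c : ℤ_[p], PowerSeries.constantCoeff ((binomPow c - 1).map (PadicComplexInt p).toSubring.subtype) = 0 :=
    fun c ↦ by
      rw [← coeff_zero_eq_constantCoeff_apply, coeff_map, coeff_zero_eq_constantCoeff_apply,
        constantCoeff_binomPow_sub_one, map_zero]
  rw [curveSubst_mul (h0 c₁) (h0 c₂), curveSubst_map_C_binomialSeries c₁ x (h0 c₂),
    curveSubst_C_binomialSeries c₂ w (h0 c₁), PowerSeries.binomialSeries_add]

end Literature.NumberTheory.EllipticCurves.IntSeries

end
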